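import Mathlib
import HarnessLib

/-!
# Route `ExtremiserTransience`, crux `NearExtremalTransiencePerFlow` (stmt-NavierStokesRegularity-26567),
# LINE g10-1 «two_thirds» (ideator ns-idea-10 g10), stub S1a `TypicalSelection` — BRICK 4c: the CELL LATTICE of a packing

`--supports stmt-NavierStokesRegularity-26567` (helper; prover seat ns-net-p2 g12).  The packings of the card are the translates of the
cubic lattice of spacing `4s` (`s` = the cell radius `4^i λ` of scale `i`); brick 4a (`…TwoThirdsTranslateAverage`) is stated for an
arbitrary basis `b` of `ℝ³`.  This file supplies the cubic basis and the three facts the per-scale bookkeeping needs: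

* `exists_cellBasis` — for `s > 0` a basis `b` of `ℝ³` with `b j = (4s)·e_j`, whose ZSpan fundamental parallelepiped is the half-open cube
  `{x : ∀ j, x j ∈ [0, 4s)}` and whose lattice `span_ℤ b` is `{x : ∀ j, x j ∈ 4s·ℤ}`;
* `dist_ge_of_mem_cellLattice` — distinct lattice points are `≥ 4s` apart (so the open balls `B(g + τ, 2s)` of one translate are pairwise
  disjoint, and the inner balls `B(g + τ, s/2)` a fortiori);
* `volume_cellCube_le` — `vol{x : ∀ j, x j ∈ [0,4s)} ≤ 16³ · vol B(0, s/2)` (the cube sits in `B(0, 8s)`; the sharp ratio is `384/π`, the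
  crude absolute constant `4096` is all the Chebyshev bookkeeping needs).
HONEST FRAMING: elementary lattice geometry; nothing about Navier–Stokes is proved; no summit is proved by a line. [folklore]
-/

noncomputable section

open scoped Topology ENNReal NNReal
open MeasureTheory Filter Set Metric Function

namespace Summit.NavierStokesRegularity.NavierStokesRegularity.Theorems.NearExtremalTransiencePerFlow.TwoThirds

-- the problem directory repeats the summit name (`NavierStokesRegularity/NavierStokesRegularity`)
set_option linter.dupNamespace false
set_option linter.style.longLine false

/-- **The cubic cell basis of spacing `4s`.**  For `s > 0` there is a basis `b` of `ℝ³` with `b j = (4s)·e_j`; its ZSpan fundamental domain is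
the half-open cube `{x : ∀ j, 0 ≤ x j < 4s}` and its `ℤ`-span is the cubic lattice `{x : ∀ j, x j ∈ 4s·ℤ}`. -/
theorem exists_cellBasis {s : ℝ} (hs : 0 < s) :
    ∃ b : Module.Basis (Fin 3) ℝ (EuclideanSpace ℝ (Fin 3)),
      (∀ j, b j = (4 * s) • EuclideanSpace.single j (1 : ℝ)) ∧
      (∀ x : EuclideanSpace ℝ (Fin 3), x ∈ ZSpan.fundamentalDomain b ↔ ∀ j, x j ∈ Set.Ico 0 (4 * s)) ∧
      (∀ x : EuclideanSpace ℝ (Fin 3), x ∈ Submodule.span ℤ (Set.range b) ↔ ∀ j, ∃ n : ℤ, x j = 4 * s * n) := by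
  classical
  have h4s : 0 < 4 * s := by positivity
  have hunit : ∀ _j : Fin 3, IsUnit (4 * s) := fun _ => isUnit_iff_ne_zero.2 h4s.ne'
  set b₀ : Module.Basis (Fin 3) ℝ (EuclideanSpace ℝ (Fin 3)) := (EuclideanSpace.basisFun (Fin 3) ℝ).toBasis with hb₀
  set b : Module.Basis (Fin 3) ℝ (EuclideanSpace ℝ (Fin 3)) := b₀.isUnitSMul hunit with hb
  have hrepr₀ : ∀ (x : EuclideanSpace ℝ (Fin 3)) (j : Fin 3), b₀.repr x j = x j := fun x j => by
    rw [hb₀, OrthonormalBasis.coe_toBasis_repr_apply, EuclideanSpace.basisFun_repr]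
  have hrepr : ∀ (x : EuclideanSpace ℝ (Fin 3)) (j : Fin 3), b.repr x j = (4 * s)⁻¹ * x j := fun x j => by
    rw [hb, Module.Basis.repr_isUnitSMul, hrepr₀, Units.smul_def, smul_eq_mul, Units.val_inv_eq_inv_val, IsUnit.unit_spec]
  refine ⟨b, fun j => ?_, fun x => ?_, fun x => ?_⟩
  · rw [hb, Module.Basis.isUnitSMul_apply, hb₀, OrthonormalBasis.coe_toBasis, EuclideanSpace.basisFun_apply]
  · rw [ZSpan.mem_fundamentalDomain]
    refine forall_congr' fun j => ?_
    rw [hrepr, Set.mem_Ico, Set.mem_Ico]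
    constructor
    · rintro ⟨h1, h2⟩
      constructor
      · by_contra hneg
        push Not at hneg
        have : (4 * s)⁻¹ * x j < 0 := mul_neg_of_pos_of_neg (inv_pos.2 h4s) hneg
        linarith
      · by_contra hge
        push Not at hge
        have : 1 ≤ (4 * s)⁻¹ * x j := by
          rw [le_inv_mul_iff₀ h4s]; simpa using hge
        linarith
    · rintro ⟨h1, h2⟩
      constructor
      · exact mul_nonneg (inv_nonneg.2 h4s.le) h1
      · rw [inv_mul_lt_iff₀ h4s]; simpa using h2
  · rw [Module.Basis.mem_span_iff_repr_mem]
    refine forall_congr' fun j => ?_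
    rw [hrepr]
    constructor
    · rintro ⟨n, hn⟩
      refine ⟨n, ?_⟩
      have hn' : (n : ℝ) = (4 * s)⁻¹ * x j := by simpa using hn
      field_simp at hn'
      linarith
    · rintro ⟨n, hn⟩
      refine ⟨n, ?_⟩
      simp only [eq_intCast]
      rw [hn]; field_simp

/-- **Distinct points of the cubic lattice are `≥ 4s` apart.** -/
theorem dist_ge_of_mem_cellLattice {s : ℝ} (hs : 0 < s) {g g' : EuclideanSpace ℝ (Fin 3)}
    (hg : ∀ j, ∃ n : ℤ, g j = 4 * s * n) (hg' : ∀ j, ∃ n : ℤ, g' j = 4 * s * n) (hne : g ≠ g') :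
    4 * s ≤ dist g g' := by
  have h4s : 0 < 4 * s := by positivity
  obtain ⟨j, hj⟩ : ∃ j, g j ≠ g' j := by
    by_contra h
    push Not at h
    exact hne (PiLp.ext h)
  obtain ⟨n, hn⟩ := hg j
  obtain ⟨n', hn'⟩ := hg' j
  have hnn : n ≠ n' := fun h => hj (by rw [hn, hn', h])
  have hz : (1 : ℝ) ≤ |(n : ℝ) - n'| := by
    have : (1 : ℤ) ≤ |n - n'| := Int.one_le_abs (sub_ne_zero.2 hnn)
    have h' : ((1 : ℤ) : ℝ) ≤ ((|n - n'| : ℤ) : ℝ) := by exact_mod_cast this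
    simpa [Int.cast_abs, Int.cast_sub] using h'
  calc 4 * s = 4 * s * 1 := by ring
    _ ≤ 4 * s * |(n : ℝ) - n'| := mul_le_mul_of_nonneg_left hz h4s.le
    _ = |g j - g' j| := by rw [hn, hn', ← mul_sub, abs_mul, abs_of_pos h4s]
    _ = dist (g j) (g' j) := (Real.dist_eq _ _).symm
    _ ≤ dist g g' := PiLp.dist_apply_le g g' j

/-- **The cell cube sits in `B(0, 8s)`.** -/
theorem cellCube_subset_ball {s : ℝ} (hs : 0 < s) :
    {x : EuclideanSpace ℝ (Fin 3) | ∀ j, x j ∈ Set.Ico 0 (4 * s)} ⊆ Metric.ball 0 (8 * s) := by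
  intro x hx
  rw [Metric.mem_ball, dist_zero_right]
  have hsq : ‖x‖ ^ 2 < (8 * s) ^ 2 := by
    rw [EuclideanSpace.real_norm_sq_eq]
    have hle : ∀ j, x j ^ 2 ≤ (4 * s) ^ 2 := fun j => by
      have := hx j
      exact pow_le_pow_left₀ this.1 this.2.le 2
    calc ∑ j, x j ^ 2 ≤ ∑ _j : Fin 3, (4 * s) ^ 2 := Finset.sum_le_sum fun j _ => hle j
      _ = 3 * (4 * s) ^ 2 := by simp
      _ < (8 * s) ^ 2 := by nlinarith
  exact lt_of_pow_lt_pow_left₀ 2 (by positivity) hsq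

/-- **Volume of the cell cube against the inner ball**: `vol{x : ∀ j, x j ∈ [0,4s)} ≤ 16³ · vol B(0, s/2)`. -/
theorem volume_cellCube_le {s : ℝ} (hs : 0 < s) :
    volume {x : EuclideanSpace ℝ (Fin 3) | ∀ j, x j ∈ Set.Ico 0 (4 * s)} ≤ 4096 * volume (Metric.ball (0 : EuclideanSpace ℝ (Fin 3)) (s / 2)) := by
  refine (measure_mono (cellCube_subset_ball hs)).trans ?_
  rw [Measure.addHaar_ball_of_pos volume _ (by positivity : (0:ℝ) < 8 * s),
    Measure.addHaar_ball_of_pos volume _ (by positivity : (0:ℝ) < s / 2), finrank_euclideanSpace, Fintype.card_fin,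
    ← mul_assoc]
  gcongr
  rw [show (4096 : ℝ≥0∞) = ENNReal.ofReal 4096 by norm_num, ← ENNReal.ofReal_mul (by norm_num)]
  exact ENNReal.ofReal_le_ofReal (by nlinarith)

end Summit.NavierStokesRegularity.NavierStokesRegularity.Theorems.NearExtremalTransiencePerFlow.TwoThirds

end
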